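import Summits.SmoothPoincare4.SmoothPoincare4.Theorems.SymplecticOrigamiOrigamiFoldExistenceShadowPleatsCleanDefs
import Summits.SmoothPoincare4.SmoothPoincare4.Theorems.SymplecticOrigamiOrigamiFoldExistenceStubPleatFreeStandardSheets

/-!
# Stub `stub_cleanOnePleatIroning` of line `shadow-pleats` for crux `OrigamiFoldExistence` — V:
# the seam sheet of a pleated position (item stmt-SmoothPoincare4-7844, route SymplecticOrigami; seat c3, S5a worker)

Fifth helper file for the registered stub `stub_cleanOnePleatIroning` (S5a), point-set input of
the TOPOLOGICAL HALF of its remaining ingredient `CleanPleatIroningChart` (sheet counting over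
the region bounded by the crease, file III docstring), written for ALL pleat numbers `k` so that
the rungs S5b/S4 and the assembly of `stub_pleatFreeStandard` can use it too.  Files II–III of
`stub_pleatFreeStandard` (seat 1) prove the local facts below under the GLOBAL `0`-pleat
hypothesis "the shadow is immersive everywhere above the plane", which fails at the fold spheres
of a pleated position; here the hypotheses are localised to the point:

* `injective_mfderiv_shadow_of_le`, `isLocalDiffeomorphAt_shadow_of_le` — ON AND BELOW the
  plane (height in `(0, 1 - δ]`) the shadow of any round-rim position is immersive / a local
  diffeomorphism: sphere geometry at the closure of the round region (`inner_mfderiv_eq_zero`),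
  no hypothesis above the plane;
* `exists_nhds_injOn_of_injective_mfderiv` — at ANY point where the shadow differential is
  injective, the shadow is an injective open map on a small open neighbourhood inside any
  prescribed open set;
* `exists_seamSheet` — **the seam sheet**: around a seam point `mₛ` (`h = 1 - δ`) there is an
  open `U ∋ mₛ`, inside any prescribed open set, on which the shadow is injective and open and
  on which a point lies STRICTLY ABOVE the plane iff its shadow lies STRICTLY INSIDE the rim
  sphere `|x| = ρ = √(1 - (1 - δ)²)` (the points of `U` over `|x| ≥ ρ` are the round points
  `polarLift x`, by the round clause and injectivity of the shadow on `U`).  This is the local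
  picture "one sheet continues the seam inwards" used by every sheet count of the line.

Sources: skeleton docstring of `stub_pleatFreeStandard`; files `…StubPleatFreeStandardSeam/Sheets`.
-/

noncomputable section

-- the prescribed namespace `Summit.<P>.<Sub>.…` duplicates `SmoothPoincare4` (P = Sub)
set_option linter.dupNamespace false

open scoped Manifold ContDiff Topology RealInnerProductSpace
open Set Function Filter Metric

namespace Summit.SmoothPoincare4.SmoothPoincare4.Theorems.OrigamiFoldExistence.ShadowPleats

section Seam

variable {M : Type} [TopologicalSpace M] [ChartedSpace (EuclideanSpace ℝ (Fin 4)) M]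
  [IsManifold (𝓡 4) ∞ M] {ι : M → EuclideanSpace ℝ (Fin 5)} {δ : ℝ}

/-- **On and below the plane the shadow of a round-rim position is immersive**: at a point of
height in `(0, 1 - δ]` the tangent space is tangent to the unit sphere (`inner_mfderiv_eq_zero`
at the closure of the round region), and a vertical tangent vector orthogonal to a point of
non-zero height vanishes.  No hypothesis above the plane is needed. [folklore] -/
theorem injective_mfderiv_shadow_of_le (hι : Manifold.IsSmoothEmbedding (𝓡 4) (𝓡 5) ∞ ι)
    (hδ : 0 < δ) (hδ1 : δ < 1)
    (hround : Set.range ι ∩ {p : EuclideanSpace ℝ (Fin 5) | p 4 ≤ 1 - δ} =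
      (Metric.sphere (0 : EuclideanSpace ℝ (Fin 5)) 1 : Set (EuclideanSpace ℝ (Fin 5))) ∩
        {p : EuclideanSpace ℝ (Fin 5) | p 4 ≤ 1 - δ})
    {m : M} (hpos : 0 < ι m 4) (hle : ι m 4 ≤ 1 - δ) :
    Injective (mfderiv (𝓡 4) (𝓡 4) (proj5 ∘ ι) m) := by
  have hcl : m ∈ closure {m' : M | ι m' 4 < 1 - δ} := by
    rcases hle.lt_or_eq with hlt | heq
    · exact subset_closure hlt
    · exact mem_closure_of_apply_eq hι hround hδ hδ1 heq
  rw [mfderiv_shadow hι m]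
  intro v₁ v₂ h
  apply injective_mfderiv_of_emb hι m
  set w₁ : EuclideanSpace ℝ (Fin 5) := mfderiv (𝓡 4) (𝓡 5) ι m v₁ with hw₁
  set w₂ : EuclideanSpace ℝ (Fin 5) := mfderiv (𝓡 4) (𝓡 5) ι m v₂ with hw₂
  have e₁ : ⟪ι m, w₁⟫ = 0 := inner_mfderiv_eq_zero hι hround hcl v₁
  have e₂ : ⟪ι m, w₂⟫ = 0 := inner_mfderiv_eq_zero hι hround hcl v₂
  have horth : ⟪ι m, w₁ - w₂⟫ = 0 := by rw [inner_sub_right, e₁, e₂, sub_zero]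
  have hshadow : proj5 (w₁ - w₂) = 0 := by
    have h' : proj5L w₁ = proj5L w₂ := h
    rw [← proj5L_apply, map_sub, h', sub_self]
  exact sub_eq_zero.1 (eq_zero_of_inner_eq_zero_of_proj5_eq_zero hpos.ne' horth hshadow)

/-- On and below the plane (height in `(0, 1 - δ]`) the shadow is a local diffeomorphism. -/
theorem isLocalDiffeomorphAt_shadow_of_le (hι : Manifold.IsSmoothEmbedding (𝓡 4) (𝓡 5) ∞ ι)
    (hδ : 0 < δ) (hδ1 : δ < 1)
    (hround : Set.range ι ∩ {p : EuclideanSpace ℝ (Fin 5) | p 4 ≤ 1 - δ} =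
      (Metric.sphere (0 : EuclideanSpace ℝ (Fin 5)) 1 : Set (EuclideanSpace ℝ (Fin 5))) ∩
        {p : EuclideanSpace ℝ (Fin 5) | p 4 ≤ 1 - δ})
    {m : M} (hpos : 0 < ι m 4) (hle : ι m 4 ≤ 1 - δ) :
    IsLocalDiffeomorphAt (𝓡 4) (𝓡 4) ∞ (proj5 ∘ ι) m :=
  isLocalDiffeomorphAt_of_injective_mfderiv_four (contMDiff_shadow hι)
    (injective_mfderiv_shadow_of_le hι hδ hδ1 hround hpos hle)

/-- **Local injectivity and openness of the shadow at an immersive point**: if the shadow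
differential at `m` is injective, the shadow is an injective open map on an open neighbourhood
of `m` inside any prescribed open `W ∋ m`. [folklore] -/
theorem exists_nhds_injOn_of_injective_mfderiv (hι : Manifold.IsSmoothEmbedding (𝓡 4) (𝓡 5) ∞ ι)
    {m : M} (hm : Injective (mfderiv (𝓡 4) (𝓡 4) (proj5 ∘ ι) m)) {W : Set M} (hW : IsOpen W)
    (hmW : m ∈ W) :
    ∃ U : Set M, IsOpen U ∧ m ∈ U ∧ U ⊆ W ∧ InjOn (proj5 ∘ ι) U ∧
      ∀ V, V ⊆ U → IsOpen V → IsOpen ((proj5 ∘ ι) '' V) := by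
  obtain ⟨Φ, hmΦ, heq⟩ := isLocalDiffeomorphAt_of_injective_mfderiv_four (contMDiff_shadow hι) hm
  refine ⟨Φ.source ∩ W, Φ.open_source.inter hW, ⟨hmΦ, hmW⟩, inter_subset_right, ?_, ?_⟩
  · intro a ha b hb hab
    have hab' : Φ a = Φ b := by rw [← heq ha.1, ← heq hb.1]; exact hab
    exact Φ.toPartialEquiv.injOn ha.1 hb.1 hab'
  · intro V hV hVopen
    have hVs : V ⊆ Φ.source := fun x hx => (hV hx).1
    have himg : (proj5 ∘ ι) '' V = Φ.toOpenPartialHomeomorph '' V :=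
      image_congr fun x hx => heq (hVs hx)
    rw [himg]
    exact Φ.toOpenPartialHomeomorph.isOpen_image_of_subset_source hVopen hVs

/-- The polar lift is continuous. -/
theorem continuous_polarLift : Continuous polarLift := by
  unfold polarLift
  fun_prop

/-- **The seam sheet.**  Let `(ι, δ)` satisfy the round clause (`ι` a `C^∞` embedding,
`0 < δ < 1`) and let `mₛ` be a seam point (`ι mₛ 4 = 1 - δ`).  Then inside any open `W ∋ mₛ`
there is an open `U ∋ mₛ` on which the shadow is injective and open, and on which a point lies
strictly above the plane IFF its shadow has norm `< ρ = √(1 - (1 - δ)²)`: over the rim and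
beyond, the only points of `U` are round points of height `≤ 1 - δ`. [folklore] -/
theorem exists_seamSheet (hι : Manifold.IsSmoothEmbedding (𝓡 4) (𝓡 5) ∞ ι) (hδ : 0 < δ)
    (hδ1 : δ < 1)
    (hround : Set.range ι ∩ {p : EuclideanSpace ℝ (Fin 5) | p 4 ≤ 1 - δ} =
      (Metric.sphere (0 : EuclideanSpace ℝ (Fin 5)) 1 : Set (EuclideanSpace ℝ (Fin 5))) ∩
        {p : EuclideanSpace ℝ (Fin 5) | p 4 ≤ 1 - δ})
    {ms : M} (hms : ι ms 4 = 1 - δ) {W : Set M} (hW : IsOpen W) (hmsW : ms ∈ W) :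
    ∃ U : Set M, IsOpen U ∧ ms ∈ U ∧ U ⊆ W ∧ InjOn (proj5 ∘ ι) U ∧
      (∀ V, V ⊆ U → IsOpen V → IsOpen ((proj5 ∘ ι) '' V)) ∧
      ∀ m ∈ U, 1 - δ < ι m 4 ↔ ‖proj5 (ι m)‖ < Real.sqrt (1 - (1 - δ) ^ 2) := by
  set ρ := Real.sqrt (1 - (1 - δ) ^ 2) with hρ
  have hρ1 : ρ < 1 := by
    rw [hρ, Real.sqrt_lt' one_pos]
    nlinarith
  have hpos : 0 < ι ms 4 := by rw [hms]; linarith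
  -- a neighbourhood of positive height where the shadow is injective and open
  have hW' : IsOpen (W ∩ {m : M | 0 < ι m 4}) :=
    hW.inter (isOpen_lt continuous_const (continuous_height hι))
  obtain ⟨U₀, hU₀, hmsU₀, hU₀W, hinj₀, himg₀⟩ :=
    exists_nhds_injOn_of_injective_mfderiv hι
      (injective_mfderiv_shadow_of_le hι hδ hδ1 hround hpos hms.le) hW' ⟨hmsW, hpos⟩
  -- the round points `polarLift x`, `ρ ≤ |x| ≤ 1`, pulled back to `M`, depend continuously on `x`
  set x₀ : EuclideanSpace ℝ (Fin 4) := proj5 (ι ms) with hx₀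
  have hx₀norm : ‖x₀‖ = ρ := norm_shadow_of_seam hround hms
  have hlift₀ : polarLift x₀ = ι ms :=
    polarLift_proj5 (mem_sphere_of_apply_le hround hms.le) hpos.le
  -- `ι '' U₀` is open in the image of the embedding: `ι ⁻¹' O = U₀` for an open `O ⊆ ℝ⁵`
  obtain ⟨O, hO, hOU⟩ := hι.isEmbedding.isInducing.isOpen_iff.1 hU₀
  -- the set of shadows whose polar lift lies in `O`
  set T : Set (EuclideanSpace ℝ (Fin 4)) := {x | ‖x‖ < 1 ∧ polarLift x ∈ O} with hT
  have hTopen : IsOpen T :=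
    (isOpen_lt continuous_norm continuous_const).inter (hO.preimage continuous_polarLift)
  have hx₀T : x₀ ∈ T := by
    refine ⟨by rw [hx₀norm]; exact hρ1, ?_⟩
    show polarLift x₀ ∈ O
    rw [hlift₀]
    have : ms ∈ ι ⁻¹' O := by rw [hOU]; exact hmsU₀
    exact this
  set U : Set M := U₀ ∩ (proj5 ∘ ι) ⁻¹' T with hU
  have hUopen : IsOpen U := hU₀.inter (hTopen.preimage (contMDiff_shadow hι).continuous)
  refine ⟨U, hUopen, ⟨hmsU₀, hx₀T⟩, fun m hm => (hU₀W hm.1).1, hinj₀.mono inter_subset_left,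
    fun V hV hVopen => himg₀ V (hV.trans inter_subset_left) hVopen, fun m hm => ?_⟩
  have hmpos : 0 < ι m 4 := (hU₀W hm.1).2
  obtain ⟨hx1, hxO⟩ := hm.2
  have hx1' : ‖proj5 (ι m)‖ < 1 := hx1
  have hxO' : polarLift (proj5 (ι m)) ∈ O := hxO
  constructor
  · -- above the plane ⇒ strictly inside the rim (else the round point over the shadow is in `U₀`)
    intro hup
    by_contra hge
    rw [not_lt] at hge
    set x := proj5 (ι m) with hx
    have hsph : polarLift x ∈ Metric.sphere (0 : EuclideanSpace ℝ (Fin 5)) 1 :=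
      polarLift_mem_sphere hx1'.le
    have hheight : polarLift x 4 ≤ 1 - δ := by
      rw [polarLift_apply_four]
      have h1 : 1 - ‖x‖ ^ 2 ≤ (1 - δ) ^ 2 := by
        have hρsq : ρ ^ 2 = 1 - (1 - δ) ^ 2 := by
          rw [hρ, Real.sq_sqrt (by nlinarith)]
        nlinarith [hge, hρsq, sq_nonneg ρ, norm_nonneg x, Real.sqrt_nonneg (1 - (1 - δ) ^ 2)]
      calc Real.sqrt (1 - ‖x‖ ^ 2) ≤ Real.sqrt ((1 - δ) ^ 2) := Real.sqrt_le_sqrt h1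
        _ = 1 - δ := Real.sqrt_sq (by linarith)
    obtain ⟨m', hm'⟩ := mem_range_of_mem_sphere hround hsph hheight
    have hm'U₀ : m' ∈ U₀ := by
      have : m' ∈ ι ⁻¹' O := by
        show ι m' ∈ O
        rw [hm']; exact hxO'
      rwa [hOU] at this
    have hsame : (proj5 ∘ ι) m' = (proj5 ∘ ι) m := by
      simp only [Function.comp_apply, hm', proj5_polarLift, hx]
    have hmm' : m' = m := hinj₀ hm'U₀ hm.1 hsame
    rw [hmm'] at hm'
    have : ι m 4 ≤ 1 - δ := by rw [hm']; exact hheight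
    linarith
  · -- strictly inside the rim ⇒ above the plane (round points of positive height lie over `|x| ≥ ρ`)
    intro hlt
    by_contra hle
    rw [not_lt] at hle
    have := rho_le_norm_shadow hround hmpos hle
    linarith

end Seam

end Summit.SmoothPoincare4.SmoothPoincare4.Theorems.OrigamiFoldExistence.ShadowPleats

end
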